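import Literature.MathematicalPhysics.QuantumLattice.InfVolFermionStateGaugeAction
import HarnessLib

/-!
# Gauge covariance of infinite-volume ground states of lattice fermions: a unique ground state is gauge invariant
# (no anomalous amplitudes); a nonzero anomalous amplitude forces a circle of distinct ground states

Topic `Literature/MathematicalPhysics/QuantumLattice` (family `hubbard`).  Sequel of `InfVolFermionStateGaugeAction.lean`
(the `U(1)` gauge transforms `ω ↦ ω ∘ γ_θ` of infinite-volume fermion states, gauge-invariant interactions, charges; there:
gauge transforms of TRANSLATION-INVARIANT ground states = mean-energy minimisers are minimisers,
`IsMeanEnergyMinimiser.gaugeShift`) — here for the Bratteli–Robinson LOCAL-STABILITY ground states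
`InfVolFermionState.IsGroundState` (`−i ω(Ãᴴ δ_Ψ A) ≥ 0` for every local `A`; Bratteli–Kishimoto–Robinson 1978), which need
not be translation invariant; the fermion twin of the spin-side «uniqueness ⇒ invariance» of
`HardCoreBosonRepulsionInfiniteVolumeGroundStates.lean` / `XXZSymmetryBreakingU1Orbit.lean`.

**What is printed.** Bratteli–Robinson II, Prop. 5.3.33 / §5.3.1 and §6.2.7: if `α` is a `*`-automorphism commuting with
the dynamics, `ω ↦ ω ∘ α` maps KMS states to KMS states and ground states to ground states; hence a UNIQUE KMS / ground
state is `α`-invariant (the standard mechanism «spontaneous symmetry breaking requires non-uniqueness», e.g. Tasaki 2022 §3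
before Cor. 3.6; Koma–Tasaki 1994 §2.4).  For the gauge group `γ_θ` of the CAR algebra (BR II §5.2.2) and a gauge-invariant
(particle-number conserving) interaction, an `α`-invariant state vanishes on every observable of non-zero charge — in
particular on every pair (anomalous) amplitude `c_p c_q`, `P_x = Σ_e g(e)(c_{x↑}c_{x+e↓} − c_{x↓}c_{x+e↑})/√2`.

## Contents (everything PROVED; no definition, no named fact)

* §1 `FermionInteraction.gaugeAut_derivation` — for a gauge-invariant interaction `γ_θ(δ_Ψ A) = δ_Ψ(γ_θ A)`;
  **`InfVolFermionState.IsGroundState.gaugeShift`** — gauge transforms of ground states are ground states.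
* §2 **`IsGroundState.isGaugeInvariant_of_unique`** — a unique infinite-volume ground state of a gauge-invariant interaction is
  gauge invariant, hence (`….expect_eq_zero_of_hasGaugeCharge_of_unique`) vanishes on every charged local observable:
  `ω(c_p c_q) = 0`, `ω(P_x) = 0` (no anomalous / pair amplitude).
* §3 THE ORBIT: `gaugeShift θ ω = gaugeShift θ' ω` and `ω(A) ≠ 0` for some charge-`q` observable force `e^{iqθ} = e^{iqθ'}`
  (`exp_eq_exp_of_gaugeShift_eq`), i.e. `θ' − θ ∈ (2π/q)ℤ` (`exists_int_of_gaugeShift_eq`); so a ground state with a nonzero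
  pair amplitude yields the pairwise-distinct ground states `ω ∘ γ_θ`, `0 ≤ θ < π` (`IsGroundState.gaugeShift_injOn_of_expect_localPairAt_ne_zero`).
* §4 THE `t–t'` HUBBARD MODEL on `ℤ²` (grand-canonical pencil `hubbardTTPrimeMuInteraction t t' U μ`, gauge invariant) and the
  Hubbard interaction on `ℤ^d`: a unique infinite-volume ground state has `ω(P_x) = 0` for every local singlet pair and every
  pair amplitude `ω(c_p c_q) = 0` (`IsGroundState.expect_localPairAt_eq_zero_of_unique_ttPrimeMu`,
  `….expect_cAt_mul_cAt_eq_zero_of_unique_hubbard`); a ground state with `ω(P_x) ≠ 0` comes with a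
  half-circle `θ ∈ [0, π)` of distinct ground states (`IsGroundState.gaugeOrbit_ttPrimeMu`).

WHAT THIS IS NOT: no statement that the Hubbard model HAS a ground state with nonzero pair amplitude (that is the summit); the
positive-temperature (dKMS) twin is filed with `FermionDKMSStates.lean`; nothing here is two-dimensional except the `t–t'` instance.

## Mathlib / tree search

`lean search 'IsGroundState.gaugeShift|isGaugeInvariant_of_unique|gaugeAut_derivation'` (2026-08-29): nothing; REUSED:
`gaugeAut` (`AlgHom`), `gaugeAut_conjTranspose`, `fermionEmbed_gaugeAut`, `HasGaugeCharge`, `hasGaugeCharge_localPairAt`,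
`hasGaugeCharge_annihilation_mul_annihilation`, `InfVolFermionState.gaugeShift`, `gaugeShift_expect(_of_hasGaugeCharge)`,
`IsGaugeInvariant.expect_eq_zero_of_hasGaugeCharge`, `FermionInteraction.IsGaugeInvariant`, `gaugeAut_localHamiltonian`,
`hubbardTTPrimeMuInteraction_isGaugeInvariant`, `hubbardFermionInteraction_isGaugeInvariant` (`InfVolFermionStateGaugeAction`,
`FockGaugeAction`); `InfVolFermionState.IsGroundState`, `FermionInteraction.derivation` (`InfVolFermionState`).

## References

* [BratteliRobinsonII1997] O. Bratteli, D. W. Robinson, *Operator Algebras and Quantum Statistical Mechanics 2*, 2nd ed. (1997),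
  §5.2.2 (gauge group, gauge-invariant states), §5.3.1 / Prop. 5.3.33 (symmetries and KMS states), Def. 5.3.18 and §6.2.7 (ground states).
* [BratteliKishimotoRobinson1978] O. Bratteli, A. Kishimoto, D. W. Robinson, Commun. Math. Phys. 64 (1978) 41–48, §1.
* [Tasaki2022] H. Tasaki, *The Lieb–Schultz–Mattis theorem: a topological point of view*, arXiv:2202.06243, §3 (before Cor. 3.6:
  uniqueness ⇒ invariance).
* [KomaTasaki1994] T. Koma, H. Tasaki, J. Stat. Phys. 76 (1994) 745–803, §2.4 and Cor. 2.9 (the `U(1)` orbit `ω_θ`).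
* [ArakiMoriya2003] H. Araki, H. Moriya, Rev. Math. Phys. 15 (2003) 93, §4.1 (gauge action on the fermion algebra), Thm. 5.13.
-/

noncomputable section

namespace Literature.MathematicalPhysics.QuantumLattice

open _root_.Matrix Finset Complex Literature.Probability.LatticeModels
open scoped ComplexOrder

variable {d : ℕ}

/-! ## §1 Gauge transforms of ground states are ground states -/

namespace FermionInteraction

/-- **The generator commutes with the gauge automorphisms** for a gauge-invariant interaction:
`γ_θ(δ_Ψ A) = δ_Ψ(γ_θ A)` (`δ_Ψ A = i[H_{Λ_R}, Ã]`, `γ_θ H_{Λ_R} = H_{Λ_R}`, `γ_θ Ã = (γ_θ A)~`).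
[cite: BratteliRobinsonII1997, §5.2.2 and Thm. 6.2.4] [cite: ArakiMoriya2003, Thm. 5.13] -/
theorem gaugeAut_derivation {Ψ : FermionInteraction d} (hΨ : Ψ.IsGaugeInvariant) (θ R : ℝ) (Λ : Finset (Site d))
    (A : FermionOp Λ) : gaugeAut θ (Ψ.derivation R Λ A) = Ψ.derivation R Λ (gaugeAut θ A) := by
  rw [derivation, derivation, map_smul, map_sub, map_mul, map_mul, gaugeAut_localHamiltonian hΨ, ← fermionEmbed_gaugeAut]

end FermionInteraction

namespace InfVolFermionState

variable {Ψ : FermionInteraction d} {R : ℝ} {ω : InfVolFermionState d}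

/-- **Gauge transforms of infinite-volume ground states are ground states** (gauge-invariant interaction): the local
stability row of `ω ∘ γ_θ` at `(Λ, A)` is the row of `ω` at `(Λ, γ_θ A)`, since `γ_θ` is a `*`-automorphism commuting with
isotony and with the generator. [cite: BratteliRobinsonII1997, Prop. 5.3.33 and §6.2.7] -/
theorem IsGroundState.gaugeShift (hΨ : Ψ.IsGaugeInvariant) (h : ω.IsGroundState Ψ R) (θ : ℝ) :
    (ω.gaugeShift θ).IsGroundState Ψ R := by
  intro Λ A
  rw [gaugeShift_expect, map_mul, gaugeAut_conjTranspose, ← fermionEmbed_gaugeAut,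
    FermionInteraction.gaugeAut_derivation hΨ]
  exact h Λ (gaugeAut θ A)

/-! ## §2 A unique ground state is gauge invariant: no anomalous amplitudes -/

/-- **A UNIQUE infinite-volume ground state of a gauge-invariant interaction is gauge invariant** (`ω ∘ γ_θ = ω` for all `θ`).
[cite: BratteliRobinsonII1997, §5.3.1 and §6.2.7] [cite: Tasaki2022, §3 (before Cor. 3.6)] -/
theorem IsGroundState.isGaugeInvariant_of_unique (hΨ : Ψ.IsGaugeInvariant) (h : ω.IsGroundState Ψ R)
    (huniq : ∀ ω' : InfVolFermionState d, ω'.IsGroundState Ψ R → ω' = ω) : ω.IsGaugeInvariant :=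
  fun θ => huniq _ (h.gaugeShift hΨ θ)

/-- **… hence it vanishes on every charged local observable**: `ω(A) = 0` whenever `γ_θ A = e^{iqθ}A` with `q ≠ 0` — no anomalous
(symmetry-breaking) amplitude in a unique ground state. [cite: BratteliRobinsonII1997, §5.2.2] [cite: KomaTasaki1994, §2.4] -/
theorem IsGroundState.expect_eq_zero_of_hasGaugeCharge_of_unique (hΨ : Ψ.IsGaugeInvariant) (h : ω.IsGroundState Ψ R)
    (huniq : ∀ ω' : InfVolFermionState d, ω'.IsGroundState Ψ R → ω' = ω) {Λ : Finset (Site d)} {q : ℤ} (hq : q ≠ 0)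
    {A : FermionOp Λ} (hA : HasGaugeCharge q A) : ω.expect Λ A = 0 :=
  (h.isGaugeInvariant_of_unique hΨ huniq).expect_eq_zero_of_hasGaugeCharge hq hA

/-- In particular **every pair amplitude `ω(c_p c_q)` vanishes** in a unique ground state (charge `−2`).
[cite: BratteliRobinsonII1997, §5.2.2] -/
theorem IsGroundState.expect_cAt_mul_cAt_eq_zero_of_unique (hΨ : Ψ.IsGaugeInvariant)
    (h : ω.IsGroundState Ψ R) (huniq : ∀ ω' : InfVolFermionState d, ω'.IsGroundState Ψ R → ω' = ω)
    {Λ : Finset (Site d)} {x y : Site d} (hx : x ∈ Λ) (hy : y ∈ Λ) (σ τ : Fin 2) :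
    ω.expect Λ (cAt x hx σ * cAt y hy τ) = 0 :=
  h.expect_eq_zero_of_hasGaugeCharge_of_unique hΨ huniq (by norm_num : (-2 : ℤ) ≠ 0)
    (hasGaugeCharge_annihilation_mul_annihilation _ _)

/-! ## §3 The gauge orbit of a state with a nonzero charged expectation -/

/-- **Equal gauge transforms force equal phases on a witnessed charge**: if `ω(A) ≠ 0` for a charge-`q` local `A` and
`ω ∘ γ_θ = ω ∘ γ_{θ'}`, then `e^{iqθ} = e^{iqθ'}`. [cite: BratteliRobinsonII1997, §5.2.2] -/
theorem exp_eq_exp_of_gaugeShift_eq {θ θ' : ℝ} (heq : ω.gaugeShift θ = ω.gaugeShift θ') {Λ : Finset (Site d)} {q : ℤ}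
    {A : FermionOp Λ} (hA : HasGaugeCharge q A) (hne : ω.expect Λ A ≠ 0) :
    Complex.exp (I * θ * q) = Complex.exp (I * θ' * q) := by
  have h1 := ω.gaugeShift_expect_of_hasGaugeCharge θ hA
  rw [heq, ω.gaugeShift_expect_of_hasGaugeCharge θ' hA] at h1
  exact (mul_right_cancel₀ hne h1).symm

/-- **… i.e. the angles differ by a multiple of `2π/q`**: `∃ k : ℤ, q·θ' = q·θ + 2πk`.
[cite: BratteliRobinsonII1997, §5.2.2] [cite: KomaTasaki1994, Cor. 2.9] -/
theorem exists_int_of_gaugeShift_eq {θ θ' : ℝ} (heq : ω.gaugeShift θ = ω.gaugeShift θ') {Λ : Finset (Site d)} {q : ℤ}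
    {A : FermionOp Λ} (hA : HasGaugeCharge q A) (hne : ω.expect Λ A ≠ 0) :
    ∃ k : ℤ, (q : ℝ) * θ' = q * θ + k * (2 * Real.pi) := by
  obtain ⟨k, hk⟩ := Complex.exp_eq_exp_iff_exists_int.1 (exp_eq_exp_of_gaugeShift_eq heq hA hne).symm
  refine ⟨k, ?_⟩
  have him := congrArg Complex.im hk
  simp only [Complex.mul_im, Complex.mul_re, Complex.ofReal_re, Complex.ofReal_im, Complex.I_re, Complex.I_im,
    Complex.intCast_re, Complex.intCast_im, Complex.add_im, Complex.re_ofNat, Complex.im_ofNat, mul_zero, zero_mul,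
    mul_one, one_mul, zero_add, add_zero, sub_zero] at him
  linarith

/-- **Distinct gauge transforms**: if `ω(A) ≠ 0` for a charge-`q` observable, `q ≠ 0`, then `θ ↦ ω ∘ γ_θ` is injective on
`[0, 2π/|q|)`. [cite: KomaTasaki1994, Cor. 2.9] [cite: BratteliRobinsonII1997, §5.2.2] -/
theorem gaugeShift_injOn_of_expect_ne_zero {Λ : Finset (Site d)} {q : ℤ} (hq : q ≠ 0) {A : FermionOp Λ}
    (hA : HasGaugeCharge q A) (hne : ω.expect Λ A ≠ 0) :
    Set.InjOn (fun θ : ℝ => ω.gaugeShift θ) (Set.Ico 0 (2 * Real.pi / |(q : ℝ)|)) := by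
  intro θ hθ θ' hθ' heq
  obtain ⟨k, hk⟩ := exists_int_of_gaugeShift_eq heq hA hne
  have hqR : (q : ℝ) ≠ 0 := by exact_mod_cast hq
  have hqa : 0 < |(q : ℝ)| := abs_pos.2 hqR
  -- `|q|·|θ' − θ| < 2π` and `q(θ' − θ) = 2πk` force `k = 0`
  have hlt : |(q : ℝ)| * |θ' - θ| < 2 * Real.pi := by
    have h1 : |θ' - θ| < 2 * Real.pi / |(q : ℝ)| := by
      rw [abs_sub_lt_iff]; constructor <;> linarith [hθ.1, hθ.2, hθ'.1, hθ'.2]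
    calc |(q : ℝ)| * |θ' - θ| < |(q : ℝ)| * (2 * Real.pi / |(q : ℝ)|) := mul_lt_mul_of_pos_left h1 hqa
      _ = 2 * Real.pi := mul_div_cancel₀ _ hqa.ne'
  have hk' : (q : ℝ) * (θ' - θ) = k * (2 * Real.pi) := by linarith
  have habs : |(k : ℝ)| * (2 * Real.pi) < 2 * Real.pi := by
    have := congrArg abs hk'
    rw [abs_mul, abs_mul, abs_of_pos Real.two_pi_pos] at this
    linarith
  have hk0 : |(k : ℝ)| < 1 := by nlinarith [Real.two_pi_pos]
  have hk00 : k = 0 := by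
    have : |k| < 1 := by exact_mod_cast hk0
    exact Int.abs_lt_one_iff.1 this
  rw [hk00, Int.cast_zero, zero_mul, mul_sub, sub_eq_zero] at hk'
  exact (mul_left_cancel₀ hqR hk').symm

/-! ## §4 The `t–t'` Hubbard model on `ℤ²` and the Hubbard interaction on `ℤ^d` -/

/-- **A UNIQUE INFINITE-VOLUME GROUND STATE OF THE `t–t'` HUBBARD PENCIL `H(t,t',U) − μN` ON `ℤ²` HAS ZERO PAIR AMPLITUDE**:
`ω(P_x) = 0` for every local singlet pair `P_x = localPairAt S g x` (any form factor `g`, e.g. `d_{x²−y²}`), any range parameter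
`R`: a nonzero superconducting order parameter in an infinite-volume ground state requires NON-UNIQUENESS of the ground state.
[cite: BratteliRobinsonII1997, §5.2.2, §6.2.7] [cite: KomaTasaki1994, §2.4] -/
theorem IsGroundState.expect_localPairAt_eq_zero_of_unique_ttPrimeMu {t t' U μ R : ℝ} {ω : InfVolFermionState 2}
    (h : ω.IsGroundState (hubbardTTPrimeMuInteraction t t' U μ) R)
    (huniq : ∀ ω' : InfVolFermionState 2, ω'.IsGroundState (hubbardTTPrimeMuInteraction t t' U μ) R → ω' = ω)
    (S : Finset (Site 2)) (g : Site 2 → ℝ) (x : Site 2) :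
    ω.expect (pairRegion S x) (localPairAt S g x) = 0 :=
  h.expect_eq_zero_of_hasGaugeCharge_of_unique (hubbardTTPrimeMuInteraction_isGaugeInvariant t t' U μ) huniq
    (by norm_num) (hasGaugeCharge_localPairAt S g x)

/-- **… and zero anomalous amplitude `ω(c_p c_q) = 0` for the Hubbard interaction on `ℤ^d`** (every `d`, `t`, `U`, `R`).
[cite: BratteliRobinsonII1997, §5.2.2, §6.2.7] -/
theorem IsGroundState.expect_cAt_mul_cAt_eq_zero_of_unique_hubbard {t U R : ℝ}
    {ω : InfVolFermionState d} (h : ω.IsGroundState (hubbardFermionInteraction d t U) R)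
    (huniq : ∀ ω' : InfVolFermionState d, ω'.IsGroundState (hubbardFermionInteraction d t U) R → ω' = ω)
    {Λ : Finset (Site d)} {x y : Site d} (hx : x ∈ Λ) (hy : y ∈ Λ) (σ τ : Fin 2) :
    ω.expect Λ (cAt x hx σ * cAt y hy τ) = 0 :=
  h.expect_cAt_mul_cAt_eq_zero_of_unique (hubbardFermionInteraction_isGaugeInvariant t U) huniq hx hy σ τ

/-- **THE GAUGE ORBIT OF A SYMMETRY-BREAKING GROUND STATE OF THE `t–t'` HUBBARD PENCIL**: if an infinite-volume ground state
`ω` has a nonzero pair amplitude `ω(P_x) ≠ 0`, then every `ω ∘ γ_θ` is a ground state, with pair amplitude `e^{−2iθ}ω(P_x)`, and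
`θ ↦ ω ∘ γ_θ` is injective on `[0, π)` — a continuum of distinct ground states (Koma–Tasaki's `ω_θ`, for electrons).
[cite: KomaTasaki1994, Cor. 2.9 and §2.4] [cite: BratteliRobinsonII1997, §5.2.2, §6.2.7] -/
theorem IsGroundState.gaugeOrbit_ttPrimeMu {t t' U μ R : ℝ} {ω : InfVolFermionState 2}
    (h : ω.IsGroundState (hubbardTTPrimeMuInteraction t t' U μ) R) {S : Finset (Site 2)} {g : Site 2 → ℝ} {x : Site 2}
    (hne : ω.expect (pairRegion S x) (localPairAt S g x) ≠ 0) :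
    (∀ θ : ℝ, (ω.gaugeShift θ).IsGroundState (hubbardTTPrimeMuInteraction t t' U μ) R ∧
      (ω.gaugeShift θ).expect (pairRegion S x) (localPairAt S g x) =
        Complex.exp (-(2 * (I * θ))) * ω.expect (pairRegion S x) (localPairAt S g x)) ∧
    Set.InjOn (fun θ : ℝ => ω.gaugeShift θ) (Set.Ico 0 Real.pi) := by
  refine ⟨fun θ => ⟨h.gaugeShift (hubbardTTPrimeMuInteraction_isGaugeInvariant t t' U μ) θ,
    ω.gaugeShift_expect_localPairAt θ S g x⟩, ?_⟩
  have hinj := gaugeShift_injOn_of_expect_ne_zero (ω := ω) (by norm_num : (-2 : ℤ) ≠ 0) (hasGaugeCharge_localPairAt S g x) hne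
  have hI : Set.Ico 0 Real.pi = Set.Ico 0 (2 * Real.pi / |((-2 : ℤ) : ℝ)|) := by
    congr 1
    push_cast
    rw [abs_neg, abs_two]
    ring
  rw [hI]
  exact hinj

end InfVolFermionState

end Literature.MathematicalPhysics.QuantumLattice

end
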